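import Mathlib
import HarnessLib
import Summits.ABC.ABC.Theses.CongruentialReceptacle
import Summits.ABC.ABC.Theorems.CongruentialReceptacleAssembly
import Literature.NumberTheory.EllipticCurves.SzpiroSixFifthsProofs

/-!
# Strength of the crux `CompactBalanceTransfer` (stmt-ABC-1725): it turns Szpiro into abc

Negative-side support file (strength certificate; the crux is implied by `ABC`, so its negative lane can only certify
STRENGTH) of the line lead of crux stmt-ABC-1725 (`prover-line-stmt-ABC-1725-0`, 2026-08-16), recording in `Theorems/`
the kernel-checked STRENGTH CERTIFICATE that both crux-ideation seats found (tree copies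
`Cruxes/CompactBalanceTransfer/SketchIdeator1.lean: crux_turns_szpiro_into_abc`, `Sketch_ideator2_r1.lean:
crux_gives_szpiro_to_abc`):

* `abc_of_freySzpiro_of_compactBalanceTransfer` — Szpiro's exponent `6 + ε` for the Frey curves of ALL abc-triples, in the
  route's elementary currency `(abc)² ≤ C·rad(abc)^(6+ε)`, together with the crux gives `ABC` (the all-triples bound is a
  fortiori the route Target `BalancedFreySzpiro`, and the route's proved `Assembly` does the rest);
* `abc_of_szpiro_of_compactBalanceTransfer : CompactBalanceTransfer → SzpiroConjecture → ABC` — the same with the tree's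
  named conjecture `Literature.NumberTheory.EllipticCurves.SzpiroConjecture`, through the minimal Frey models of
  Bombieri–Gubler 12.5.10 with the discriminant clause (`exists_minimal_frey_model_disc`).

So a proof of the crux is verbatim a proof of the implication "Szpiro's conjecture ⟹ the abc conjecture (exponent 1+ε)",
open since Oesterlé 1988 (known unconditionally from Szpiro: exponent 3/2, and 6/5 via the 2-isogenous curve,
`Literature.NumberTheory.EllipticCurves.abc_sixFifths_of_szpiro_holds`). This is why the lead reports the line's single stub as
crux-sized rather than attempting it (NOTES / `Cruxes/CompactBalanceTransfer/Lines/Sketch.md`).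
-/

-- `Summit.<Summit>.<Problem>`: for the single-conjunct summit `ABC` the duplicate `ABC.ABC` is mandated.
set_option linter.dupNamespace false

namespace Summit.ABC.ABC.Theorems.CompactBalanceTransfer.Negative

open Literature.NumberTheory.DiophantineGeometry
open Literature.NumberTheory.EllipticCurves
open Summit.ABC.ABC.Theses.CongruentialReceptacle

/-- **Strength certificate, elementary currency.** Szpiro `6 + ε` for the Frey curves of ALL abc-triples
(`(abc)² ≤ C·rad(abc)^(6+ε)`, Oesterlé's "forme forte") and the crux `CompactBalanceTransfer` give `ABC`: the all-triples
bound restricts to the route Target `BalancedFreySzpiro`, and the proved `Assembly`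
(`congruentialReceptacle_assembly_proof`) composes it with the transfer. [folklore] -/
theorem abc_of_freySzpiro_of_compactBalanceTransfer
    (hF : ∀ ε : ℝ, 0 < ε → ∃ C : ℝ, ∀ a b c : ℕ, IsABCTriple a b c →
      ((a * b * c : ℕ) : ℝ) ^ 2 ≤ C * ((rad a b c : ℕ) : ℝ) ^ (6 + ε))
    (hT : CompactBalanceTransfer) : _root_.ABC := by
  refine Summit.ABC.ABC.Theorems.congruentialReceptacle_assembly_proof ?_ hT
  intro κ _hκ ε hε
  obtain ⟨C, hC⟩ := hF ε hε
  exact ⟨C, fun a b c habc _ _ => hC a b c habc⟩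

/-- B–G 12.5.10 packaged with the DISCRIMINANT clause: every abc triple carries a global minimal Frey model `W₀`
over `ℤ` with `cond ∣ 2¹⁰ rad(abc)` and `(abc)² ≤ 2⁸ |Δ(W₀)|` ((12.17): `Δ = 16(abc)²`; (12.18): `Δ = 2⁻⁸(abc)²`).
(Copy of `exists_minimal_frey_model` with the `c₄` clause replaced; from the crux-ideation sketch of stmt-ABC-1725.) [folklore] -/
theorem exists_minimal_frey_model_disc {a b c : ℕ} (h : IsABCTriple a b c) :
    ∃ W₀ : WeierstrassCurve ℤ, (W₀.baseChange ℚ).IsElliptic ∧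
      (∀ v : IsDedekindDomain.HeightOneSpectrum ℤ, (W₀.baseChange ℚ).IsMinimalAt v) ∧
      (W₀.baseChange ℚ).conductorNorm ℤ ∣ 2 ^ 10 * rad a b c ∧
      ((a * b * c : ℕ) : ℤ) ^ 2 ≤ 2 ^ 8 * |W₀.Δ| := by
  have h' := h
  obtain ⟨ha, hb, habc, hcop⟩ := h'
  have hc : 0 < c := by omega
  have habc0 : a * b * c ≠ 0 := by positivity
  by_cases h16 : 16 ∣ a * b * c
  · obtain ⟨A, B, hAB, hA, hB, hprod, -⟩ := exists_arrangement h h16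
    have h0 : A * B * (A + B) ≠ 0 := by
      rw [← Int.natAbs_ne_zero, hprod]; exact habc0
    have h4 : 4 ∣ B - A - 1 := by
      have : B - A - 1 = B - (A + 1) := by ring
      rw [this]; exact dvd_sub (dvd_trans (by norm_num) hB) hA
    have h16' : 16 ∣ A * B := dvd_mul_of_dvd_right hB _
    refine ⟨freyIntModel₂ A B, isElliptic_freyIntModel₂ h0 h4 h16', isMinimalAt_freyIntModel₂ hAB hA hB,
      ?_, ?_⟩
    · rw [rad_def, ← hprod]
      exact (conductorNorm_freyIntModel₂_dvd hAB h0 hA hB).trans (dvd_mul_left _ _)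
    · rw [freyIntModel₂_Δ h4 h16']
      obtain ⟨e, he⟩ := h16'
      have he' : A * B / 16 = e := by rw [he]; simp
      have hcast : ((a * b * c : ℕ) : ℤ) ^ 2 = (A * B * (A + B)) ^ 2 := by
        rw [← hprod, Int.natCast_natAbs, sq_abs]
      rw [hcast, he', show (A * B * (A + B)) ^ 2 = 2 ^ 8 * (e ^ 2 * (A + B) ^ 2) by rw [he]; ring,
        abs_of_nonneg (by positivity)]
  · have hab : IsCoprime (a : ℤ) (b : ℤ) := Nat.isCoprime_iff_coprime.mpr hcop
    have hP : (a : ℤ) * b * (a + b) = ((a * b * c : ℕ) : ℤ) := by rw [← habc]; push_cast; ring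
    have h0 : (a : ℤ) * b * (a + b) ≠ 0 := by rw [hP]; exact_mod_cast habc0
    have h16' : ¬ (16 : ℤ) ∣ (a : ℤ) * b * (a + b) := by
      rw [hP]; exact_mod_cast mt Int.natCast_dvd_natCast.mp h16
    refine ⟨freyIntModel a b, isElliptic_freyIntModel h0, isMinimalAt_freyIntModel hab h0 h16', ?_, ?_⟩
    · have := conductorNorm_freyIntModel_dvd hab h0 h16'
      rwa [hP, Int.natAbs_natCast, ← rad_def] at this
    · rw [freyIntModel_Δ, hP, abs_of_nonneg (by positivity)]
      nlinarith [sq_nonneg (((a * b * c : ℕ) : ℤ))]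

/-- Szpiro's conjecture (the tree's named open conjecture `SzpiroConjecture`, all `E/ℚ`, exponent `6 + ε`) gives the
"forme forte" shape `(abc)² ≤ C·rad(abc)^(6+ε)` on the Frey curves of ALL abc-triples (via `exists_minimal_frey_model_disc`:
`(abc)² ≤ 2⁸|Δ_min|`, `N ∣ 2¹⁰ rad`). [folklore] -/
theorem freySzpiro_of_szpiro (hS : SzpiroConjecture) :
    ∀ ε : ℝ, 0 < ε → ∃ C : ℝ, ∀ a b c : ℕ, IsABCTriple a b c →
      ((a * b * c : ℕ) : ℝ) ^ 2 ≤ C * ((rad a b c : ℕ) : ℝ) ^ (6 + ε) := by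
  intro ε hε
  obtain ⟨C₁, hC₁⟩ := hS ε hε
  set C : ℝ := max C₁ 1 with hCdef
  have hC0 : 0 ≤ C := le_trans zero_le_one (le_max_right _ _)
  refine ⟨2 ^ 8 * C * ((2 : ℝ) ^ 10) ^ (6 + ε), ?_⟩
  intro a b c h
  obtain ⟨W₀, hE, hmin, hN, hdisc⟩ := exists_minimal_frey_model_disc h
  haveI := hE
  have key := hC₁ (W₀.baseChange ℚ)
  rw [WeierstrassCurve.minimalDiscriminantNorm_eq_natAbs_holds W₀
      (WeierstrassCurve.Δ_ne_zero_of_isElliptic_baseChange_int W₀) hmin,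
    Nat.cast_natAbs, Int.cast_abs] at key
  set N : ℝ := (((W₀.baseChange ℚ).conductorNorm ℤ : ℕ) : ℝ) with hNdef
  set R : ℝ := ((rad a b c : ℕ) : ℝ) with hRdef
  have hN0 : 0 ≤ N := by positivity
  have hR0 : 0 ≤ R := by positivity
  have h1 : |(W₀.Δ : ℝ)| ≤ C * N ^ (6 + ε) :=
    key.trans (mul_le_mul_of_nonneg_right (le_max_left _ _) (by positivity))
  have h2 : N ≤ 2 ^ 10 * R := by
    have := Nat.le_of_dvd (mul_pos (by positivity)
      (by rw [rad_def]; exact Nat.radical_pos _)) hN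
    rw [hNdef, hRdef]; exact_mod_cast this
  have h3 : ((a * b * c : ℕ) : ℝ) ^ 2 ≤ 2 ^ 8 * |(W₀.Δ : ℝ)| := by exact_mod_cast hdisc
  have hε6 : (0 : ℝ) ≤ 6 + ε := by linarith
  calc ((a * b * c : ℕ) : ℝ) ^ 2 ≤ 2 ^ 8 * |(W₀.Δ : ℝ)| := h3
    _ ≤ 2 ^ 8 * (C * N ^ (6 + ε)) := by linarith
    _ ≤ 2 ^ 8 * (C * (2 ^ 10 * R) ^ (6 + ε)) := by gcongr
    _ = (2 ^ 8 * C * ((2 : ℝ) ^ 10) ^ (6 + ε)) * R ^ (6 + ε) := by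
        rw [Real.mul_rpow (by positivity) hR0]; ring


/-- **Strength certificate, named-conjecture currency**: `CompactBalanceTransfer → SzpiroConjecture → ABC`. Any proof of the
crux stmt-ABC-1725 proves "Szpiro's conjecture implies the abc conjecture" (open; unconditionally Szpiro is known to give only
abc-exponent `6/5`, `abc_sixFifths_of_szpiro_holds`). [folklore] -/
theorem abc_of_szpiro_of_compactBalanceTransfer (hT : CompactBalanceTransfer) (hS : SzpiroConjecture) : _root_.ABC :=
  abc_of_freySzpiro_of_compactBalanceTransfer (freySzpiro_of_szpiro hS) hT

end Summit.ABC.ABC.Theorems.CompactBalanceTransfer.Negative
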